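import Mathlib
import Summits.ValiantsHypothesis.ValiantsHypothesis.Theorems.GeneratorObstructionsPerGenDegreeSuperQPPaddedReduction

/-!
# Route GeneratorObstructions — crux K1 `PerGenDegreeSuperQP` (stmt-ValiantsHypothesis-11654), line
# `per-side-atoms`: K1 from the padded certificate at ONE FIXED block exponent `k`

Helper file (`--supports stmt-ValiantsHypothesis-11654`).  Companion of
`…PerGenDegreeSuperQPPaddedReduction(Upper)`, which reduces K1 to the padded certificate at the
parameters `k = 2^t`, `c = 4^t` of crux K2.  For K1 the block exponent `k` is FREE: the padded gadget
`p = x_z^{(c-1)5k+1} Σ_{j<c} x_{B j}^k x_{A j}^{2k} x_{A' j}^{2k}` is a form of degree `m = 5kc+1` in the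
`m² ≥ 3c+1` matrix letters for EVERY `k ≥ 1`, it lies in `Δ(per_m)` (hub construction) and its lateness
is `2^c` (doubling).  So it suffices to have the certificate for one fixed `k` and all `c ≥ 2`:

* `padded_parameters_fixed` — at `c = 4^t`, `t = 2(2c₁+4)²`, `k ≤ 2^t`:
  `(5k·4^t+1) · 2^((log₂(5k·4^t+1) + c₁)^c₁) < 2^(4^t)` (monotonicity from `padded_parameters_at`);
* `perGenDegreeSuperQP_of_paddedGadgetGIT_fixed` — **K1 from the padded certificate at a fixed
  `k ≥ 1`**, for all `c ≥ 2` and all placements onto a final segment (padding letter topmost);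
* `perGenDegreeSuperQP_of_paddedGadgetGIT_one` — the case `k = 1` with the gadget written plainly
  (`x_B · x_A² · x_{A'}²`, padding exponent `5(c-1)+1`, `m = 5c+1`): the form in which the explicit
  padded tableau certificate is being built (block count `blockSum 1`, no parity input needed).

Honest framing: conditional reductions by name; no stub (`stub_atomLate`), crux or summit is settled
here; `VP ≠ VNP` untouched. [cite: GesmundoIkenmeyerPanova2017, Prop. 5]
-/

namespace Summit.ValiantsHypothesis.ValiantsHypothesis.Theorems.GeneratorObstructions.PerGenDegreeSuperQP

open MvPolynomial
open Literature.NumberTheory.DiophantineGeometry Literature.Computability.AlgebraicComplexity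
open Summit.ValiantsHypothesis.ValiantsHypothesis.Theses.GeneratorObstructions
open Summit.ValiantsHypothesis.ValiantsHypothesis.Theorems.GenInheritance

-- `Summit.ValiantsHypothesis.ValiantsHypothesis.…` is the tree's mandated single-conjunct layout.
set_option linter.dupNamespace false

noncomputable section

/-! ## §1 Parameters -/

/-- The padded parameters at a fixed block exponent: with `t = 2(2c₁+4)²`, `k ≤ 2^t`, `c = 4^t`,
`m = 5kc + 1`: `m · 2^((log₂ m + c₁)^c₁) < 2^c` (monotonicity in `m` from `padded_parameters_at`).
[folklore] -/
theorem padded_parameters_fixed (k c₁ t : ℕ) (ht : t = 2 * (2 * c₁ + 2 + 2) ^ 2) (hkt : k ≤ 2 ^ t) :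
    (5 * k * 4 ^ t + 1) * 2 ^ ((Nat.log 2 (5 * k * 4 ^ t + 1) + c₁) ^ c₁) < 2 ^ (4 ^ t) := by
  have hm : 5 * k * 4 ^ t + 1 ≤ 5 * 2 ^ t * 4 ^ t + 1 := by
    have := Nat.mul_le_mul_right (4 ^ t) (Nat.mul_le_mul_left 5 hkt)
    omega
  have hlog : Nat.log 2 (5 * k * 4 ^ t + 1) ≤ Nat.log 2 (5 * 2 ^ t * 4 ^ t + 1) :=
    Nat.log_mono_right hm
  calc (5 * k * 4 ^ t + 1) * 2 ^ ((Nat.log 2 (5 * k * 4 ^ t + 1) + c₁) ^ c₁)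
      ≤ (5 * 2 ^ t * 4 ^ t + 1) * 2 ^ ((Nat.log 2 (5 * 2 ^ t * 4 ^ t + 1) + c₁) ^ c₁) :=
        Nat.mul_le_mul hm (Nat.pow_le_pow_right (by norm_num)
          (Nat.pow_le_pow_left (by omega) _))
    _ < 2 ^ (4 ^ t) := padded_parameters_at c₁ t ht

/-! ## §2 K1 from the padded certificate at a fixed block exponent -/

/-- **K1 from the padded certificate at a fixed `k ≥ 1`.**  If for some fixed `k ≥ 1`, every `c ≥ 2`
(`m = 5kc+1`) and every strictly monotone `ι : Fin (3c+1) → MatIdx m` onto a final segment some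
highest-weight vector of NONCONSTANT weight of `ℂ[Δ_m p]` does not vanish at the padded gadget
`p = x_{ι(3c)}^{(c-1)5k+1} Σ_{j<c} x_{ι(B j)}^k x_{ι(A j)}^{2k} x_{ι(A' j)}^{2k}`, then `PerGenDegreeSuperQP`
(K1): `per_late_genType_of_paddedGIT` at `c = 4^t`, `t = 2(2c₁+4)²`, `c₁ = max(c₀, m₀, k)`, and
`padded_parameters_fixed`. [cite: GesmundoIkenmeyerPanova2017, Prop. 5] -/
theorem perGenDegreeSuperQP_of_paddedGadgetGIT_fixed {k : ℕ} (hk : 1 ≤ k)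
    (hGIT : ∀ (c : ℕ), 2 ≤ c → ∀ (ι : Fin (3 * c + 1) → MatIdx (5 * k * c + 1)),
      StrictMono ι → IsUpperSet (Set.range ι) →
      ∃ χ₀ : Weight (MatIdx (5 * k * c + 1)), (∃ a b, χ₀ a ≠ χ₀ b) ∧
        ∃ y ∈ highestWeightSpace (orbitCoordRep
            ((X (ι ⟨3 * c, Nat.lt_succ_self _⟩)) ^ ((c - 1) * (5 * k) + 1) *
              ∑ j : Fin c,
                X (ι ⟨if j.val = 0 then 0 else 3 * j.val - 1, (canonPos_lt_succ j).1⟩) ^ k *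
                  (X (ι ⟨3 * j.val + 1, (canonPos_lt_succ j).2.1⟩) ^ (2 * k) *
                    X (ι ⟨if j.val = c - 1 then 3 * c - 1 else 3 * j.val + 3,
                      (canonPos_lt_succ j).2.2⟩) ^ (2 * k)) :
                MvPolynomial (MatIdx (5 * k * c + 1)) ℂ) (5 * k * c + 1)) χ₀,
          evalAtPoint ((X (ι ⟨3 * c, Nat.lt_succ_self _⟩)) ^ ((c - 1) * (5 * k) + 1) *
              ∑ j : Fin c,
                X (ι ⟨if j.val = 0 then 0 else 3 * j.val - 1, (canonPos_lt_succ j).1⟩) ^ k *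
                  (X (ι ⟨3 * j.val + 1, (canonPos_lt_succ j).2.1⟩) ^ (2 * k) *
                    X (ι ⟨if j.val = c - 1 then 3 * c - 1 else 3 * j.val + 3,
                      (canonPos_lt_succ j).2.2⟩) ^ (2 * k)) :
                MvPolynomial (MatIdx (5 * k * c + 1)) ℂ) (5 * k * c + 1) y ≠ 0) :
    PerGenDegreeSuperQP := by
  intro c₀ m₀
  set c₁ : ℕ := max (max c₀ m₀) k with hc₁
  set t : ℕ := 2 * (2 * c₁ + 2 + 2) ^ 2 with htdef
  have ht1 : 1 ≤ t := by rw [htdef]; nlinarith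
  have hkc₁ : k ≤ c₁ := le_max_right _ _
  have hc₁t : c₁ ≤ t := by rw [htdef]; nlinarith
  have htt : t ≤ 2 ^ t := Nat.lt_two_pow_self.le
  have hkt : k ≤ 2 ^ t := hkc₁.trans (hc₁t.trans htt)
  have hc2 : 2 ≤ 4 ^ t :=
    calc (2 : ℕ) ≤ 4 ^ 1 := by norm_num
      _ ≤ 4 ^ t := Nat.pow_le_pow_right (by norm_num) ht1
  have hc1 : 1 ≤ 4 ^ t := by omega
  -- a strictly monotone placement of the `3c + 1` letters onto a final segment (`3c+1 ≤ m²`)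
  have hcard : Fintype.card (Fin (3 * 4 ^ t + 1)) ≤
      Fintype.card (MatIdx (5 * k * 4 ^ t + 1)) := by
    rw [Fintype.card_fin, Fintype.card_lex, Fintype.card_prod, Fintype.card_fin]
    have hX : 3 * 4 ^ t + 1 ≤ 5 * k * 4 ^ t + 1 := by
      have := Nat.mul_le_mul_right (4 ^ t) (show 3 ≤ 5 * k by omega)
      omega
    exact hX.trans (Nat.le_mul_self _)
  obtain ⟨ι, hι, hup⟩ := exists_strictMono_isUpperSet (σ := Fin (3 * 4 ^ t + 1))
    (τ := MatIdx (5 * k * 4 ^ t + 1)) hcard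
  obtain ⟨χ, -, hge, hγ⟩ := per_late_genType_of_paddedGIT (k := k) (c := 4 ^ t)
    (m := 5 * k * 4 ^ t + 1) hk hc1 rfl ι hι (hGIT (4 ^ t) hc2 ι hι hup)
  refine ⟨5 * k * 4 ^ t + 1, ?_, χ, hγ, ?_⟩
  · -- `m₀ ≤ c₁ ≤ t ≤ 2^t ≤ 4^t ≤ m`
    have h3 : m₀ ≤ c₁ := (le_max_right _ _).trans (le_max_left _ _)
    have h4 : 2 ^ t ≤ 4 ^ t := Nat.pow_le_pow_left (by norm_num) _
    nlinarith [hc1]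
  · -- lateness, with `c₀ ≤ c₁`
    have hlate := padded_parameters_fixed k c₁ t htdef hkt
    have hc₀ : c₀ ≤ c₁ := (le_max_left _ _).trans (le_max_left _ _)
    have hmono : (Nat.log 2 (5 * k * 4 ^ t + 1) + c₀) ^ c₀ ≤
        (Nat.log 2 (5 * k * 4 ^ t + 1) + c₁) ^ c₁ :=
      calc (Nat.log 2 (5 * k * 4 ^ t + 1) + c₀) ^ c₀
          ≤ (Nat.log 2 (5 * k * 4 ^ t + 1) + c₁) ^ c₀ := Nat.pow_le_pow_left (by omega) _
        _ ≤ (Nat.log 2 (5 * k * 4 ^ t + 1) + c₁) ^ c₁ := by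
            rcases Nat.eq_zero_or_pos c₀ with h0 | hpos
            · rw [h0, pow_zero]; exact Nat.one_le_pow _ _ (by omega)
            · exact Nat.pow_le_pow_right (by omega) hc₀
    have hlate' : (5 * k * 4 ^ t + 1) * 2 ^ ((Nat.log 2 (5 * k * 4 ^ t + 1) + c₀) ^ c₀) <
        2 ^ (4 ^ t) :=
      lt_of_le_of_lt (Nat.mul_le_mul_left _ (Nat.pow_le_pow_right (by norm_num) hmono)) hlate
    have hcast : ((5 * k * 4 ^ t + 1 : ℕ) : ℤ) *
        2 ^ ((Nat.log 2 (5 * k * 4 ^ t + 1) + c₀) ^ c₀) < (2 : ℤ) ^ (4 ^ t) := by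
      exact_mod_cast hlate'
    push_cast at hcast ⊢
    exact lt_of_lt_of_le hcast hge

/-! ## §3 The case `k = 1` -/

/-- **K1 from the padded certificate at `k = 1`**, gadget written plainly: if for every `c ≥ 2`
(`m = 5c+1`) and every strictly monotone `ι : Fin (3c+1) → MatIdx m` onto a final segment some
highest-weight vector of NONCONSTANT weight of `ℂ[Δ_m p]` does not vanish at
`p = x_{ι(3c)}^{5(c-1)+1} Σ_{j<c} x_{ι(B j)} x_{ι(A j)}² x_{ι(A' j)}²`, then `PerGenDegreeSuperQP` (K1).
[cite: GesmundoIkenmeyerPanova2017, Prop. 5] -/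
theorem perGenDegreeSuperQP_of_paddedGadgetGIT_one
    (hGIT : ∀ (c : ℕ), 2 ≤ c → ∀ (ι : Fin (3 * c + 1) → MatIdx (5 * c + 1)),
      StrictMono ι → IsUpperSet (Set.range ι) →
      ∃ χ₀ : Weight (MatIdx (5 * c + 1)), (∃ a b, χ₀ a ≠ χ₀ b) ∧
        ∃ y ∈ highestWeightSpace (orbitCoordRep
            ((X (ι ⟨3 * c, Nat.lt_succ_self _⟩)) ^ (5 * (c - 1) + 1) *
              ∑ j : Fin c,
                X (ι ⟨if j.val = 0 then 0 else 3 * j.val - 1, (canonPos_lt_succ j).1⟩) *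
                  (X (ι ⟨3 * j.val + 1, (canonPos_lt_succ j).2.1⟩) ^ 2 *
                    X (ι ⟨if j.val = c - 1 then 3 * c - 1 else 3 * j.val + 3,
                      (canonPos_lt_succ j).2.2⟩) ^ 2) :
                MvPolynomial (MatIdx (5 * c + 1)) ℂ) (5 * c + 1)) χ₀,
          evalAtPoint ((X (ι ⟨3 * c, Nat.lt_succ_self _⟩)) ^ (5 * (c - 1) + 1) *
              ∑ j : Fin c,
                X (ι ⟨if j.val = 0 then 0 else 3 * j.val - 1, (canonPos_lt_succ j).1⟩) *
                  (X (ι ⟨3 * j.val + 1, (canonPos_lt_succ j).2.1⟩) ^ 2 *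
                    X (ι ⟨if j.val = c - 1 then 3 * c - 1 else 3 * j.val + 3,
                      (canonPos_lt_succ j).2.2⟩) ^ 2) :
                MvPolynomial (MatIdx (5 * c + 1)) ℂ) (5 * c + 1) y ≠ 0) :
    PerGenDegreeSuperQP := by
  refine perGenDegreeSuperQP_of_paddedGadgetGIT_fixed (k := 1) le_rfl fun c hc ι hι hup => ?_
  -- `5 * 1 * c + 1 = 5 * c + 1` definitionally up to `Nat.mul_one`; transport along the cast
  have hm : 5 * 1 * c + 1 = 5 * c + 1 := by ring
  -- rewrite the gadget at `k = 1` into the plain form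
  have key : ∀ (m : ℕ) (hmm : m = 5 * c + 1) (κ : Fin (3 * c + 1) → MatIdx m), StrictMono κ →
      IsUpperSet (Set.range κ) →
      ∃ χ₀ : Weight (MatIdx m), (∃ a b, χ₀ a ≠ χ₀ b) ∧
        ∃ y ∈ highestWeightSpace (orbitCoordRep
            ((X (κ ⟨3 * c, Nat.lt_succ_self _⟩)) ^ ((c - 1) * (5 * 1) + 1) *
              ∑ j : Fin c,
                X (κ ⟨if j.val = 0 then 0 else 3 * j.val - 1, (canonPos_lt_succ j).1⟩) ^ 1 *
                  (X (κ ⟨3 * j.val + 1, (canonPos_lt_succ j).2.1⟩) ^ (2 * 1) *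
                    X (κ ⟨if j.val = c - 1 then 3 * c - 1 else 3 * j.val + 3,
                      (canonPos_lt_succ j).2.2⟩) ^ (2 * 1)) :
                MvPolynomial (MatIdx m) ℂ) m) χ₀,
          evalAtPoint ((X (κ ⟨3 * c, Nat.lt_succ_self _⟩)) ^ ((c - 1) * (5 * 1) + 1) *
              ∑ j : Fin c,
                X (κ ⟨if j.val = 0 then 0 else 3 * j.val - 1, (canonPos_lt_succ j).1⟩) ^ 1 *
                  (X (κ ⟨3 * j.val + 1, (canonPos_lt_succ j).2.1⟩) ^ (2 * 1) *
                    X (κ ⟨if j.val = c - 1 then 3 * c - 1 else 3 * j.val + 3,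
                      (canonPos_lt_succ j).2.2⟩) ^ (2 * 1)) :
                MvPolynomial (MatIdx m) ℂ) m y ≠ 0 := by
    intro m hmm κ hκ hκup
    subst hmm
    have hpoly : ((X (κ ⟨3 * c, Nat.lt_succ_self _⟩)) ^ ((c - 1) * (5 * 1) + 1) *
              ∑ j : Fin c,
                X (κ ⟨if j.val = 0 then 0 else 3 * j.val - 1, (canonPos_lt_succ j).1⟩) ^ 1 *
                  (X (κ ⟨3 * j.val + 1, (canonPos_lt_succ j).2.1⟩) ^ (2 * 1) *
                    X (κ ⟨if j.val = c - 1 then 3 * c - 1 else 3 * j.val + 3,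
                      (canonPos_lt_succ j).2.2⟩) ^ (2 * 1)) :
                MvPolynomial (MatIdx (5 * c + 1)) ℂ) =
        (X (κ ⟨3 * c, Nat.lt_succ_self _⟩)) ^ (5 * (c - 1) + 1) *
              ∑ j : Fin c,
                X (κ ⟨if j.val = 0 then 0 else 3 * j.val - 1, (canonPos_lt_succ j).1⟩) *
                  (X (κ ⟨3 * j.val + 1, (canonPos_lt_succ j).2.1⟩) ^ 2 *
                    X (κ ⟨if j.val = c - 1 then 3 * c - 1 else 3 * j.val + 3,
                      (canonPos_lt_succ j).2.2⟩) ^ 2) := by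
      simp only [pow_one, Nat.mul_one, Nat.mul_comm (c - 1) 5]
    rw [hpoly]
    exact hGIT c hc κ hκ hκup
  exact key (5 * 1 * c + 1) hm ι hι hup

end

end Summit.ValiantsHypothesis.ValiantsHypothesis.Theorems.GeneratorObstructions.PerGenDegreeSuperQP
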